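import Literature.MathematicalPhysics.QuantumFieldTheory.Balaban1983to89.B6Cov2110MatrixV1
import Literature.MathematicalPhysics.QuantumFieldTheory.Balaban1983to89.B6Cov2110WeightV1

/-!
# `Balaban1983to89.B6Cov2110DecayV1` — T. Bałaban, *Propagators and renormalization transformations for lattice gauge
# theories. II*, Commun. Math. Phys. **96** (1984) 223–250 [Balaban1984PropagatorsII], p. 242 (text after (2.110)): **«a covariance C^{(j)}_Λ of
# the last Gaussian integrals in (2.106) is a bounded operator with an exponential decay independent of j and Λ» — THE EXPONENTIAL DECAY, FOR THE
# CONCRETE TWO-SCALE DATA `tsV1`**: there is a rate `δ₀ = δ₀(d, L) > 0` with `|⟨e_x, C^{(j)}_Λe_{x′}⟩| ≤ (2/γ₀)·e^{−δ₀|x̂ − x̂′|_T}` for all sites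
# of the unit torus `T^{(j)}` (`x̂` the anchor of the block of `x`), uniformly in the volume, in `j`, in `Λ′` and in the weights — by the
# Combes–Thomas route

statement-level skeleton of published theorems with citation tags; proofs where landed; nothing here is a claim about the Yang–Mills mass gap

PDF held: `paper:balaban1984-cmp96-propagators-rt-ii` (journal page = PDF page + 222; p. 242 [PDF 20] read AS IMAGE on the ×2 render
`run/shared/lean/pub/pub-balaban/b2b-balaban-ref1/pages/1984-cmp96-propagators-rt-II/…-p020-x2.png`, 2026-08-21).

PRINT (verbatim, p. 242).  *"Hence γ₀‖ω‖² ≤ ⟨ω, Δ′_jω⟩ ≤ γ₁‖ω‖² for ω : Q′₁ω = 0, (2.110) with positive constants γ₀, γ₁ dependent on d and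
L only. From the theorem on unit lattice operators in [3] it follows that a covariance C^{(j)}_Λ of the last Gaussian integrals in (2.106) is a
bounded operator with an exponential decay independent of j and Λ."*  ([3] = [Balaban1983RegularityDecay].)

CITATION HEADER (lean-in-tree rule) — WHAT IS REPRODUCED.  Phase-2 file of the `lit-balaban` typed skeleton (HOME
`run/shared/lean/pub/lit-balaban/`), seat **p22 gen 12** (B6 fold owner r03, referee ref-4; lane = the Sect. C chain (2.95)–(2.147) on the
concrete two-scale data `tsV1`).  SKELETON row **B6.Eq2.110** (*"(2.110) + C^{(j)}_Λ"*): the «exponential decay» clause, INSTANCED for the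
concrete model — the last open hypothesis (`hSe`) of the chain `…B6Cov2110CombesThomas` (abstract Combes–Thomas step, gen 11) →
`…B6Cov2110MatrixV1.cov_kernel_decay_of_herr` (the concrete `C^{(j)}_Λ = covOp S₁ Δ′_j` meets the abstract hypotheses up to the Schur bound
`hSe` for a block-constant weight) is DISCHARGED here.  ROUTE: NOT the random walk expansion of [3] but the Combes–Thomas conjugation the papers
name elsewhere ([Balaban1984PropagatorsI] p. 36, [Balaban1984PropagatorsII] p. 237).  IMPORTS BY NAME: the kernel decay of the concrete `Δ′_j`
`…B6DeltaPrimeKernelTwoScaleV1.kernel_Dp_decay_rep` (r03's `…B6DeltaPrimeKernelTorus.norm_dPOp_le`), p21/r02's uniform torus sum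
`…B5Hk163TorusHolderRate.sum_exp_torusSupNorm_sub_rep_le` (`Σ_t e^{−a|y − rep t|_T} ≤ latticeConst(d+1, a)`), gen 11's bookkeeping
`…B6Cov2110WeightV1.weight_sub_le/schur_symm/conjError_ge/torusSupNorm_neg/_zero/_sub_le/_anchor_le`, `…B6Cov2110MatrixV1.siteMatrix_apply_eq_inner/
DpMatrix_isSymm/cov_kernel_decay_of_herr`, pv23's `Beta.CombesThomasForm.abs_exp_sub_one_le`.  THIS FILE (parameter set written
`⟨d + 1, L, m, K, _, _⟩` as r03's torus sup-metric is `Fin (d + 1)`-indexed — every `P : Params` has this form; `κ = κ_N(d+1)/(d+1)` r03's rate,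
`θ = (c/L^j)⁴L^{j(d+1)}` the V1 normalisation, `Θ = M_Δ′(d+1)·periodConst(κ_N(d+1), d)`, `A(d, L) = e^{κ(L−1)}·(4/κ + 2(L−1))·latticeConst(d+1, κ/4)`):
* §1 `pointwise_le` (private, real analysis): `(e^{δ(D + 2l)} − 1)·s ≤ δ·Θ′e^{κl}(4/κ + 2l)·e^{−(κ/4)D}` whenever `0 ≤ s ≤ Θ′e^{−κD}`, `0 ≤ δ ≤ κ/2`;
* §2 **`rowSum_le`**: the row sums of the Schur majorant of the matrix `S` of `Δ′_j` in the site basis,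
  `Σ_{x′}(e^{δ(|x − x′|_T + 2(L−1))} − 1)|S(x, x′)| ≤ δ·θ·Θ·A(d, L)` for `0 ≤ δ ≤ κ/2` — uniformly in the volume, `Λ′` and the weights;
* §3 **`herr_V1`**: the conjugation-error (Schur) hypothesis `hSe` of `cov_kernel_decay_of_herr` HOLDS for the block-anchored weight
  `φ(x) = δ|x̂ − a|_T` as soon as `0 ≤ δ ≤ κ/2` and `δ·Θ·A ≤ c₀(d+1)(8/L²)²/2` — `θ` CANCELS against `γ₀ = θc₀(8/L²)²`;
* §4 **`cov_kernel_decay_of_le`** (any such `δ`), **`delta0_pos`**, **`cov_kernel_decay`**: with the explicit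
  `δ₀(d, L) = min(κ/2, c₀(d+1)(8/L²)²/(2(Θ·A + 1))) > 0`, `|⟨e_x, C^{(j)}_Λe_{x′}⟩| ≤ (2/γ₀)·e^{−δ₀|x̂ − x̂′|_T}`; **`cov_kernel_decay_sites`**: the same
  with `e^{2δ₀(L−1)}·e^{−δ₀|x − x′|_T}`; **`cov_kernel_decay_uniform`**: `∀ d L, ∃ δ > 0, ∀ m K c j Λ′ w x x′, …` — *«an exponential decay independent of
  j and Λ»* with the order of quantifiers literal (the rate depends on `d, L` only; the prefactor `2/γ₀` carries the V1 normalisation `θ`).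
THEOREMS ONLY (no definition, no `def … : Prop` fact); standard axioms.  HONEST SCOPE: an ENTRY bound in the site basis of the finite unit torus
`T^{(j)}` of the V1 calculus, in the torus sup-metric of lattice representatives (between block anchors, resp. sites); crude explicit constants
(ours; `δ₀` depends on `d, L` only, NOT the paper's); `L` odd, centred blocks; the covariance is gen 7's typed `C^{(j)}_Λ = covOp S₁ Δ′_j` of
`tsV1 hc Λ′ w` (`c ≠ 0`, `j + 1 ≤ m + K`, weights `w > 0`); NOT summit progress.
-/

noncomputable section

open scoped InnerProductSpace
open Finset Matrix

namespace Literature.MathematicalPhysics.QuantumFieldTheory.Balaban1983to89.B6Cov2110DecayV1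

open LatticeFieldCalculus B6SectAOperatorsV1 B6SectCTwoScaleV1 B6SectCTwoScaleV1Lattice
open B4TorusKernel (periodConst)
open B4TorusKernel.MultiPeriod (torusSupNorm torusSupNorm_nonneg)
open B5Eq117TorusCarriers (Mk)
open B4Sect5Proof (latticeConst latticeConst_nonneg)
open B5Hk163Strip (kappaN kappaN_pos)
open B5Hk163TorusHolderRate (sum_exp_torusSupNorm_sub_rep_le)
open B6LowerBound2153Torus (rep)
open B6Cov2156Torus (one_le_M)
open B6Hprime2101 (MdP MdP_nonneg c0_2109 c0_2109_pos)
open B6DeltaPrimeKernelTwoScaleV1 (kernel_Dp_decay_rep)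
open B6Cov2110MatrixV1 (siteMatrix_apply_eq_inner DpMatrix_isSymm cov_kernel_decay_of_herr)
open B6Cov2110WeightV1 (torusSupNorm_neg torusSupNorm_zero torusSupNorm_sub_le torusSupNorm_anchor_le weight_sub_le schur_symm
  conjError_ge)
open Beta.CombesThomasForm (abs_exp_sub_one_le)

/-! ## §0  Local notation (hygiene off: the identifiers `d L m K hd hL c j hc Λ' w` are resolved at each use site) -/

set_option hygiene false in
/-- the parameter set `(d + 1, L, m, K)`. -/
local notation "P₀" => (⟨d + 1, L, m, K, hd, hL⟩ : Params)

set_option hygiene false in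
/-- the period vector of the unit torus `T^{(j)}`. -/
local notation "M₀" => Mk (⟨d + 1, L, m, K, hd, hL⟩ : Params) j

set_option hygiene false in
/-- r03's decay rate `κ = κ_N(d+1)/(d+1)` of the kernel of `Δ′_j`. -/
local notation "κ₀" => (kappaN (d + 1) / ((d : ℝ) + 1))

set_option hygiene false in
/-- the V1 normalisation `θ = (c/L^j)⁴L^{j(d+1)}`. -/
local notation "θ₀" => ((c / (L : ℝ) ^ j) ^ 4 * ((L : ℝ) ^ j) ^ (d + 1))

set_option hygiene false in
/-- r03's prefactor `Θ = M_Δ′(d+1)·periodConst(κ_N(d+1), d)` of the kernel bound of `Δ′_j`. -/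
local notation "Θ₀" => (MdP (d + 1) * periodConst (kappaN (d + 1)) d)

set_option hygiene false in
/-- the row-sum constant `A(d, L) = e^{κ(L−1)}(4/κ + 2(L−1))·latticeConst(d+1, κ/4)`. -/
local notation "A₀" => (Real.exp (κ₀ * ((L : ℝ) - 1)) * (4 / κ₀ + 2 * ((L : ℝ) - 1)) * latticeConst (d + 1) (κ₀ / 4))

set_option hygiene false in
/-- the lower constant `γ₀ = θc₀(d+1)(8/L²)²` of (2.110) for `tsV1`. -/
local notation "γ₀" => (θ₀ * (c0_2109 (d + 1) * (8 / (L : ℝ) ^ 2) ^ 2))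

set_option hygiene false in
/-- the explicit rate `δ₀(d, L) = min(κ/2, c₀(d+1)(8/L²)²/(2(ΘA + 1)))`. -/
local notation "δ₀" => (min (κ₀ / 2) (c0_2109 (d + 1) * (8 / (L : ℝ) ^ 2) ^ 2 / (2 * (Θ₀ * A₀ + 1))))

set_option hygiene false in
/-- the matrix of `Δ′_j` in the site basis of `ℓ²(T^{(j)})`. -/
local notation "S₀" => (Matrix.of fun x x' : Site P₀ j => (tsV1 hc Λ' w).Dp (EuclideanSpace.single x' (1 : ℝ)) x)

set_option hygiene false in
/-- the matrix of the orthogonal projection onto the admissible `ω`. -/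
local notation "Pa₀" => (Matrix.of fun x x' : Site P₀ j => (admissible P₀ j Λ').starProjection (EuclideanSpace.single x' (1 : ℝ)) x)

set_option hygiene false in
/-- the anchor `x̂ = blockSite (y(x)) 0` of the block of a site, as a lattice representative. -/
local notation "anc[" x "]" => rep M₀ (Site.blockSite (blockOf x) fun _ => ⟨0, Params.L_pos _⟩)

/-! ## §1  The pointwise majorant (real analysis) and the signs of the constants -/

section Pointwise

/-- the pointwise majorant behind the row-sum bound: for `0 ≤ s ≤ Θe^{−κD}`, `0 ≤ δ ≤ κ/2`, `D, l ≥ 0`,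
`(e^{δ(D + 2l)} − 1)s ≤ δ·Θe^{κl}(4/κ + 2l)·e^{−(κ/4)D}` (`e^t − 1 ≤ te^t`, `De^{−(κ/4)D} ≤ 4/κ`). [folklore] -/
private theorem pointwise_le {κ δ D l Θ s : ℝ} (hκ : 0 < κ) (hδ0 : 0 ≤ δ) (hδ : δ ≤ κ / 2) (hD : 0 ≤ D) (hl : 0 ≤ l)
    (hs0 : 0 ≤ s) (hs : s ≤ Θ * Real.exp (-(κ * D))) :
    (Real.exp (δ * (D + 2 * l)) - 1) * s ≤ δ * (Θ * (Real.exp (κ * l) * (4 / κ + 2 * l))) * Real.exp (-(κ / 4 * D)) := by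
  have hΘ : 0 ≤ Θ := by
    by_contra h
    have : Θ * Real.exp (-(κ * D)) < 0 := mul_neg_of_neg_of_pos (not_le.1 h) (Real.exp_pos _)
    linarith
  have ht0 : 0 ≤ δ * (D + 2 * l) := by positivity
  have h1 : Real.exp (δ * (D + 2 * l)) - 1 ≤ δ * (D + 2 * l) * Real.exp (δ * (D + 2 * l)) := by
    have h2 : 1 - δ * (D + 2 * l) ≤ Real.exp (-(δ * (D + 2 * l))) := by linarith [Real.add_one_le_exp (-(δ * (D + 2 * l)))]
    have h3 : Real.exp (δ * (D + 2 * l)) * Real.exp (-(δ * (D + 2 * l))) = 1 := by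
      rw [← Real.exp_add, add_neg_cancel, Real.exp_zero]
    nlinarith [Real.exp_pos (δ * (D + 2 * l)), mul_le_mul_of_nonneg_left h2 (Real.exp_pos (δ * (D + 2 * l))).le]
  have hA : Real.exp (δ * (D + 2 * l)) * Real.exp (-(κ * D)) ≤
      Real.exp (κ * l) * Real.exp (-(κ / 4 * D)) * Real.exp (-(κ / 4 * D)) := by
    rw [← Real.exp_add, ← Real.exp_add, ← Real.exp_add]
    refine Real.exp_le_exp.2 ?_
    nlinarith [mul_le_mul_of_nonneg_right hδ hD, mul_le_mul_of_nonneg_right hδ hl]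
  have hB : D * Real.exp (-(κ / 4 * D)) ≤ 4 / κ := by
    have h3 : κ / 4 * D ≤ Real.exp (κ / 4 * D) := by linarith [Real.add_one_le_exp (κ / 4 * D)]
    have h4 : Real.exp (κ / 4 * D) * Real.exp (-(κ / 4 * D)) = 1 := by rw [← Real.exp_add, add_neg_cancel, Real.exp_zero]
    rw [le_div_iff₀ hκ]
    calc D * Real.exp (-(κ / 4 * D)) * κ = 4 * (κ / 4 * D * Real.exp (-(κ / 4 * D))) := by ring
      _ ≤ 4 * (Real.exp (κ / 4 * D) * Real.exp (-(κ / 4 * D))) :=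
          mul_le_mul_of_nonneg_left (mul_le_mul_of_nonneg_right h3 (Real.exp_pos _).le) (by norm_num)
      _ = 4 := by rw [h4, mul_one]
  have hC : Real.exp (-(κ / 4 * D)) ≤ 1 := Real.exp_le_one_iff.2 (neg_nonpos.2 (by positivity))
  calc (Real.exp (δ * (D + 2 * l)) - 1) * s ≤ δ * (D + 2 * l) * Real.exp (δ * (D + 2 * l)) * s :=
        mul_le_mul_of_nonneg_right h1 hs0
    _ ≤ δ * (D + 2 * l) * Real.exp (δ * (D + 2 * l)) * (Θ * Real.exp (-(κ * D))) := mul_le_mul_of_nonneg_left hs (by positivity)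
    _ = δ * Θ * (D + 2 * l) * (Real.exp (δ * (D + 2 * l)) * Real.exp (-(κ * D))) := by ring
    _ ≤ δ * Θ * (D + 2 * l) * (Real.exp (κ * l) * Real.exp (-(κ / 4 * D)) * Real.exp (-(κ / 4 * D))) :=
        mul_le_mul_of_nonneg_left hA (by positivity)
    _ = δ * Θ * Real.exp (κ * l) * (D * Real.exp (-(κ / 4 * D)) + 2 * l * Real.exp (-(κ / 4 * D))) * Real.exp (-(κ / 4 * D)) := by
        ring
    _ ≤ δ * Θ * Real.exp (κ * l) * (4 / κ + 2 * l) * Real.exp (-(κ / 4 * D)) := by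
        refine mul_le_mul_of_nonneg_right (mul_le_mul_of_nonneg_left ?_ (by positivity)) (Real.exp_pos _).le
        have : 2 * l * Real.exp (-(κ / 4 * D)) ≤ 2 * l := mul_le_of_le_one_right (by positivity) hC
        linarith
    _ = δ * (Θ * (Real.exp (κ * l) * (4 / κ + 2 * l))) * Real.exp (-(κ / 4 * D)) := by ring

variable {d L : ℕ} {c : ℝ} {j : ℕ}

/-- `κ > 0`. [folklore] -/
private theorem kappa_pos : 0 < κ₀ := div_pos (kappaN_pos _) (by positivity)

/-- `Θ ≥ 0` (`M_Δ′ ≥ 0` and `periodConst(κ, d) > 0` for `κ > 0`). [folklore] -/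
private theorem Theta_nonneg : 0 ≤ Θ₀ := by
  have h1 : 0 < κ₀ := kappa_pos
  have h2 : Real.exp (-κ₀) < 1 := by
    have h := Real.exp_lt_exp.2 (neg_lt_zero.2 h1)
    rwa [Real.exp_zero] at h
  have h3 : 0 < periodConst (kappaN (d + 1)) d := by
    unfold periodConst
    exact pow_pos (div_pos (by positivity) (by linarith)) _
  exact mul_nonneg (MdP_nonneg _) h3.le

/-- `L − 1 ≥ 0`. [folklore] -/
private theorem l_nonneg (hL' : Odd L ∧ 1 < L) : 0 ≤ (L : ℝ) - 1 := by
  have h : (1 : ℝ) ≤ L := by exact_mod_cast hL'.2.le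
  linarith

/-- `A(d, L) ≥ 0`. [folklore] -/
private theorem A_nonneg (hL' : Odd L ∧ 1 < L) : 0 ≤ A₀ := by
  have hκ : 0 < κ₀ := kappa_pos
  have hl := l_nonneg hL'
  have h1 : 0 ≤ 4 / κ₀ + 2 * ((L : ℝ) - 1) := by positivity
  exact mul_nonneg (mul_nonneg (Real.exp_pos _).le h1) (latticeConst_nonneg (d + 1) (div_pos hκ (by norm_num : (0 : ℝ) < 4)).le)

/-- `θ > 0` (`c ≠ 0`). [folklore] -/
private theorem theta_pos (hc' : c ≠ 0) (hL' : Odd L ∧ 1 < L) : 0 < θ₀ := by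
  have hLp : (0 : ℝ) < L := by have := hL'.2; exact_mod_cast (show 0 < L by omega)
  have h4 : 0 < (c / (L : ℝ) ^ j) ^ 4 := Even.pow_pos ⟨2, rfl⟩ (div_ne_zero hc' (pow_ne_zero _ hLp.ne'))
  exact mul_pos h4 (pow_pos (pow_pos hLp _) _)

/-- **`δ₀(d, L) > 0`** — the rate depends on `d` and `L` only. [cite: Balaban1984PropagatorsII, p.242 (text after (2.110))] -/
theorem delta0_pos (hL' : Odd L ∧ 1 < L) : 0 < δ₀ := by
  have hκ : 0 < κ₀ := kappa_pos
  have hX : 0 ≤ Θ₀ * A₀ := mul_nonneg Theta_nonneg (A_nonneg hL')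
  have hL0 : 0 < L := by have := hL'.2; omega
  have hLp : (0 : ℝ) < L := by exact_mod_cast hL0
  have h8 : 0 < (8 / (L : ℝ) ^ 2) ^ 2 := by positivity
  exact lt_min (half_pos hκ) (div_pos (mul_pos (c0_2109_pos _) h8) (mul_pos two_pos (by linarith)))

/-- `δ₀ ≤ κ/2`. [folklore] -/
private theorem delta0_le : δ₀ ≤ κ₀ / 2 := min_le_left _ _

/-- `δ₀·Θ·A ≤ c₀(8/L²)²/2`. [folklore] -/
private theorem delta0_mul_le (hL' : Odd L ∧ 1 < L) : δ₀ * (Θ₀ * A₀) ≤ c0_2109 (d + 1) * (8 / (L : ℝ) ^ 2) ^ 2 / 2 := by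
  have hX : 0 ≤ Θ₀ * A₀ := mul_nonneg Theta_nonneg (A_nonneg hL')
  have hB : 0 ≤ c0_2109 (d + 1) * (8 / (L : ℝ) ^ 2) ^ 2 := by have := c0_2109_pos (d + 1); positivity
  calc δ₀ * (Θ₀ * A₀) ≤ c0_2109 (d + 1) * (8 / (L : ℝ) ^ 2) ^ 2 / (2 * (Θ₀ * A₀ + 1)) * (Θ₀ * A₀) :=
        mul_le_mul_of_nonneg_right (min_le_right _ _) hX
    _ ≤ c0_2109 (d + 1) * (8 / (L : ℝ) ^ 2) ^ 2 / 2 := by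
        rw [div_mul_eq_mul_div, div_le_div_iff₀ (by linarith) (by norm_num)]
        nlinarith

end Pointwise

/-! ## §2  The row sums of the Schur majorant of the matrix of `Δ′_j` -/

section Decay

/-! r03's torus sup-metric `torusSupNorm` and entry decay are written with the dimension as `d + 1`; accordingly the parameter set is written
here as `⟨d + 1, L, m, K, _, _⟩` — EVERY `P : Params` is of this form (`P.hd : 1 ≤ P.d`; destructure `P` to apply). -/

variable {d L m K : ℕ} {hd : 1 ≤ d + 1} {hL : Odd L ∧ 1 < L} {c : ℝ} (hc : c ≠ 0) {j : ℕ}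
  (Λ' : Finset (Site (⟨d + 1, L, m, K, hd, hL⟩ : Params) (j + 1))) {w : CIdx j Λ' → ℝ} (hw : ∀ i, 0 < w i)

/-- **THE ROW SUMS OF THE SCHUR MAJORANT**: for `0 ≤ δ ≤ κ/2` and every site `x` of `T^{(j)}`,
`Σ_{x′}(e^{δ(|x − x′|_T + 2(L−1))} − 1)·|S(x, x′)| ≤ δ·θ·Θ·A(d, L)` — uniformly in the volume, in `Λ′` and in the weights (the kernel decay of the
concrete `Δ′_j`, `kernel_Dp_decay_rep`, and the uniform torus sum `sum_exp_torusSupNorm_sub_rep_le` BY NAME).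
[cite: Balaban1984PropagatorsII, (2.108)–(2.110) p.242] -/
theorem rowSum_le (hj : j ≤ m + K) {δ : ℝ} (hδ0 : 0 ≤ δ) (hδ : δ ≤ κ₀ / 2) (x : Site P₀ j) :
    ∑ x' : Site P₀ j, (Real.exp (δ * (torusSupNorm M₀ (rep M₀ x - rep M₀ x') + 2 * ((L : ℝ) - 1))) - 1) * |S₀ x x'| ≤
      δ * (θ₀ * Θ₀ * A₀) := by
  have hκ : 0 < κ₀ := kappa_pos
  have hl : 0 ≤ (L : ℝ) - 1 := l_nonneg hL
  have hΘ : 0 ≤ Θ₀ := Theta_nonneg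
  have hθ : 0 ≤ θ₀ := (theta_pos (j := j) (d := d) hc hL).le
  have hpt : ∀ x' : Site P₀ j, (Real.exp (δ * (torusSupNorm M₀ (rep M₀ x - rep M₀ x') + 2 * ((L : ℝ) - 1))) - 1) * |S₀ x x'| ≤
      δ * (θ₀ * Θ₀ * (Real.exp (κ₀ * ((L : ℝ) - 1)) * (4 / κ₀ + 2 * ((L : ℝ) - 1)))) *
        Real.exp (-(κ₀ / 4 * torusSupNorm M₀ (rep M₀ x - rep M₀ x'))) := fun x' => by
    refine pointwise_le hκ hδ0 hδ (torusSupNorm_nonneg (one_le_M M₀) _) hl (abs_nonneg _) ?_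
    rw [siteMatrix_apply_eq_inner]
    have h := kernel_Dp_decay_rep hc Λ' w hj x x'
    simpa only [mul_assoc] using h
  have h1 : 0 ≤ 4 / κ₀ + 2 * ((L : ℝ) - 1) := by positivity
  calc ∑ x' : Site P₀ j, (Real.exp (δ * (torusSupNorm M₀ (rep M₀ x - rep M₀ x') + 2 * ((L : ℝ) - 1))) - 1) * |S₀ x x'|
      ≤ ∑ x' : Site P₀ j, δ * (θ₀ * Θ₀ * (Real.exp (κ₀ * ((L : ℝ) - 1)) * (4 / κ₀ + 2 * ((L : ℝ) - 1)))) *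
          Real.exp (-(κ₀ / 4 * torusSupNorm M₀ (rep M₀ x - rep M₀ x'))) := Finset.sum_le_sum fun x' _ => hpt x'
    _ = δ * (θ₀ * Θ₀ * (Real.exp (κ₀ * ((L : ℝ) - 1)) * (4 / κ₀ + 2 * ((L : ℝ) - 1)))) *
          ∑ x' : Site P₀ j, Real.exp (-(κ₀ / 4 * torusSupNorm M₀ (rep M₀ x - rep M₀ x'))) := by rw [Finset.mul_sum]
    _ ≤ δ * (θ₀ * Θ₀ * (Real.exp (κ₀ * ((L : ℝ) - 1)) * (4 / κ₀ + 2 * ((L : ℝ) - 1)))) * latticeConst (d + 1) (κ₀ / 4) := by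
        refine mul_le_mul_of_nonneg_left ?_ ?_
        · exact sum_exp_torusSupNorm_sub_rep_le M₀ (div_pos hκ (by norm_num)) (rep M₀ x)
        · exact mul_nonneg hδ0 (mul_nonneg (mul_nonneg hθ hΘ) (mul_nonneg (Real.exp_pos _).le h1))
    _ = δ * (θ₀ * Θ₀ * A₀) := by ring

/-! ## §3  The conjugation-error (Schur) hypothesis `hSe` for the block-anchored torus weight -/

include hw in
/-- **THE SCHUR BOUND `hSe` HOLDS FOR THE CONCRETE `Δ′_j`**: for the block-constant weight `φ(x) = δ|x̂ − a|_T` (`x̂` the anchor of the block of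
`x`, any base point `a`) with `0 ≤ δ ≤ κ/2` and `δ·Θ·A(d, L) ≤ c₀(d+1)(8/L²)²/2`, the Combes–Thomas conjugation error of the matrix `S` of `Δ′_j`
on `range P` is `≥ −(γ₀/2)‖Pu‖²`, `γ₀ = θc₀(8/L²)²` — the V1 normalisation `θ` cancels (`weight_sub_le`, `abs_exp_sub_one_le`, `conjError_ge`,
`schur_symm`, `rowSum_le`). [cite: Balaban1984PropagatorsII, p.242 (text after (2.110))] -/
theorem herr_V1 (hj : j + 1 ≤ m + K) {δ : ℝ} (hδ0 : 0 ≤ δ) (hδ : δ ≤ κ₀ / 2)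
    (hδ' : δ * (Θ₀ * A₀) ≤ c0_2109 (d + 1) * (8 / (L : ℝ) ^ 2) ^ 2 / 2) (a : Fin (d + 1) → ℤ) (u : Site P₀ j → ℝ) :
    -(γ₀ / 2) * (Pa₀ *ᵥ u ⬝ᵥ Pa₀ *ᵥ u) ≤
      ∑ x, ∑ x', (Real.exp (δ * torusSupNorm M₀ (anc[x] - a) - δ * torusSupNorm M₀ (anc[x'] - a)) - 1) * S₀ x x' *
        ((Pa₀ *ᵥ u) x * (Pa₀ *ᵥ u) x') := by
  have hl : 0 ≤ (L : ℝ) - 1 := l_nonneg hL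
  set v := Pa₀ *ᵥ u with hv
  set k : Site P₀ j → Site P₀ j → ℝ := fun x x' =>
    (Real.exp (δ * (torusSupNorm M₀ (rep M₀ x - rep M₀ x') + 2 * ((L : ℝ) - 1))) - 1) * |S₀ x x'| with hk
  have hbound : ∀ x x' : Site P₀ j,
      |Real.exp (δ * torusSupNorm M₀ (anc[x] - a) - δ * torusSupNorm M₀ (anc[x'] - a)) - 1| * |S₀ x x'| ≤ k x x' :=
    fun x x' => mul_le_mul_of_nonneg_right (abs_exp_sub_one_le (weight_sub_le hj hδ0 a x x')) (abs_nonneg _)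
  have h1 := conjError_ge S₀ (fun x => δ * torusSupNorm M₀ (anc[x] - a)) k hbound v
  have hsymm : ∀ x x' : Site P₀ j, k x x' = k x' x := fun x x' => by
    simp only [hk]
    rw [← neg_sub (rep M₀ x') (rep M₀ x), torusSupNorm_neg, (DpMatrix_isSymm hc hj Λ' hw).apply x' x]
  have hk0 : ∀ x x' : Site P₀ j, 0 ≤ k x x' := fun x x' => by
    simp only [hk]
    refine mul_nonneg ?_ (abs_nonneg _)
    have h0 : 0 ≤ δ * (torusSupNorm M₀ (rep M₀ x - rep M₀ x') + 2 * ((L : ℝ) - 1)) :=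
      mul_nonneg hδ0 (by linarith [torusSupNorm_nonneg (one_le_M M₀) (rep M₀ x - rep M₀ x')])
    linarith [Real.add_one_le_exp (δ * (torusSupNorm M₀ (rep M₀ x - rep M₀ x') + 2 * ((L : ℝ) - 1)))]
  have hR : ∀ x : Site P₀ j, ∑ x', k x x' ≤ δ * (θ₀ * Θ₀ * A₀) := fun x => rowSum_le hc Λ' (Nat.le_of_succ_le hj) hδ0 hδ x
  have h2 := schur_symm k hsymm hk0 hR v
  have hθ := theta_pos (j := j) (d := d) hc hL
  have h3 : δ * (θ₀ * Θ₀ * A₀) ≤ γ₀ / 2 := by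
    have h := mul_le_mul_of_nonneg_left hδ' hθ.le
    calc δ * (θ₀ * Θ₀ * A₀) = θ₀ * (δ * (Θ₀ * A₀)) := by ring
      _ ≤ θ₀ * (c0_2109 (d + 1) * (8 / (L : ℝ) ^ 2) ^ 2 / 2) := h
      _ = γ₀ / 2 := by ring
  have h4 : v ⬝ᵥ v = ∑ x, v x ^ 2 := by simp only [dotProduct, sq]
  have h5 : 0 ≤ ∑ x, v x ^ 2 := Finset.sum_nonneg fun x _ => sq_nonneg _
  rw [h4]
  calc -(γ₀ / 2) * ∑ x, v x ^ 2 ≤ -(δ * (θ₀ * Θ₀ * A₀) * ∑ x, v x ^ 2) := by nlinarith [mul_le_mul_of_nonneg_right h3 h5]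
    _ ≤ -(∑ x, ∑ x', k x x' * (|v x| * |v x'|)) := by linarith
    _ ≤ _ := h1

/-! ## §4  «… a bounded operator with an exponential decay independent of j and Λ» for the concrete model -/

include hw in
/-- **EXPONENTIAL DECAY OF THE KERNEL OF `C^{(j)}_Λ`, ANY ADMISSIBLE RATE**: for `0 ≤ δ ≤ κ/2` with `δ·Θ·A(d, L) ≤ c₀(d+1)(8/L²)²/2`,
`|⟨e_x, C^{(j)}_Λe_{x′}⟩| ≤ (2/γ₀)·e^{−δ|x̂ − x̂′|_T}` (`x̂, x̂′` the block anchors; `cov_kernel_decay_of_herr` with `herr_V1` at the base point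
`a = x̂′`). [cite: Balaban1984PropagatorsII, p.242 (text after (2.110))] -/
theorem cov_kernel_decay_of_le (hj : j + 1 ≤ m + K) {δ : ℝ} (hδ0 : 0 ≤ δ) (hδ : δ ≤ κ₀ / 2)
    (hδ' : δ * (Θ₀ * A₀) ≤ c0_2109 (d + 1) * (8 / (L : ℝ) ^ 2) ^ 2 / 2) (x x' : Site P₀ j) :
    |⟪EuclideanSpace.single x (1 : ℝ), (tsV1 hc Λ' w).C (EuclideanSpace.single x' (1 : ℝ))⟫_ℝ| ≤
      2 / γ₀ * Real.exp (-(δ * torusSupNorm M₀ (anc[x] - anc[x']))) := by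
  have h := cov_kernel_decay_of_herr hc hj Λ' hw (fun Y => δ * torusSupNorm M₀
      (rep M₀ (Site.blockSite Y fun _ => ⟨0, Params.L_pos _⟩) - anc[x'])) (fun u => herr_V1 hc Λ' hw hj hδ0 hδ hδ' _ u) x x'
  simp only [sub_self, torusSupNorm_zero, mul_zero, sub_zero] at h
  exact h

include hw in
/-- **«A COVARIANCE C^{(j)}_Λ … WITH AN EXPONENTIAL DECAY INDEPENDENT OF j AND Λ», FOR THE CONCRETE TWO-SCALE DATA** (explicit rate): with
`δ₀(d, L) = min(κ/2, c₀(d+1)(8/L²)²/(2(ΘA + 1))) > 0` (`delta0_pos`), for all sites `x, x′` of the unit torus `T^{(j)}`,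
`|⟨e_x, C^{(j)}_Λe_{x′}⟩| ≤ (2/γ₀)·e^{−δ₀|x̂ − x̂′|_T}` — uniformly in the volume `(m, K)`, in `j`, in `Λ′` and in the weights.
[cite: Balaban1984PropagatorsII, p.242 (text after (2.110))] -/
theorem cov_kernel_decay (hj : j + 1 ≤ m + K) (x x' : Site P₀ j) :
    |⟪EuclideanSpace.single x (1 : ℝ), (tsV1 hc Λ' w).C (EuclideanSpace.single x' (1 : ℝ))⟫_ℝ| ≤
      2 / γ₀ * Real.exp (-(δ₀ * torusSupNorm M₀ (anc[x] - anc[x']))) :=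
  cov_kernel_decay_of_le hc Λ' hw hj (delta0_pos hL).le delta0_le (delta0_mul_le hL) x x'

include hw in
/-- **THE SAME BETWEEN THE SITES THEMSELVES**: `|⟨e_x, C^{(j)}_Λe_{x′}⟩| ≤ (2/γ₀)·e^{2δ₀(L−1)}·e^{−δ₀|x − x′|_T}` (each site is within `L − 1` of its
block anchor, `torusSupNorm_anchor_le`). [cite: Balaban1984PropagatorsII, p.242 (text after (2.110))] -/
theorem cov_kernel_decay_sites (hj : j + 1 ≤ m + K) (x x' : Site P₀ j) :
    |⟪EuclideanSpace.single x (1 : ℝ), (tsV1 hc Λ' w).C (EuclideanSpace.single x' (1 : ℝ))⟫_ℝ| ≤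
      2 / γ₀ * Real.exp (2 * δ₀ * ((L : ℝ) - 1)) * Real.exp (-(δ₀ * torusSupNorm M₀ (rep M₀ x - rep M₀ x'))) := by
  have h := cov_kernel_decay hc Λ' hw hj x x'
  have hδ := (delta0_pos (d := d) hL).le
  have hγ : 0 ≤ 2 / γ₀ := by
    have := theta_pos (j := j) (d := d) hc hL
    have := c0_2109_pos (d + 1)
    positivity
  -- `|x − x′|_T ≤ |x̂ − x̂′|_T + 2(L − 1)`
  have htri : torusSupNorm M₀ (rep M₀ x - rep M₀ x') ≤ torusSupNorm M₀ (anc[x] - anc[x']) + 2 * ((L : ℝ) - 1) := by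
    have h1 : torusSupNorm M₀ (rep M₀ x - rep M₀ x') ≤
        torusSupNorm M₀ (rep M₀ x - anc[x]) + torusSupNorm M₀ (anc[x] - anc[x']) + torusSupNorm M₀ (anc[x'] - rep M₀ x') :=
      (torusSupNorm_sub_le M₀ (rep M₀ x) (anc[x']) (rep M₀ x')).trans (by linarith [torusSupNorm_sub_le M₀ (rep M₀ x) (anc[x]) (anc[x'])])
    have h2 : torusSupNorm M₀ (rep M₀ x - anc[x]) ≤ (L : ℝ) - 1 := torusSupNorm_anchor_le hj x
    have h3 : torusSupNorm M₀ (anc[x'] - rep M₀ x') ≤ (L : ℝ) - 1 := by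
      rw [← torusSupNorm_neg M₀, neg_sub]
      exact torusSupNorm_anchor_le hj x'
    linarith
  have hexp : Real.exp (-(δ₀ * torusSupNorm M₀ (anc[x] - anc[x']))) ≤
      Real.exp (2 * δ₀ * ((L : ℝ) - 1)) * Real.exp (-(δ₀ * torusSupNorm M₀ (rep M₀ x - rep M₀ x'))) := by
    rw [← Real.exp_add]
    exact Real.exp_le_exp.2 (by nlinarith [mul_le_mul_of_nonneg_left htri hδ])
  calc |⟪EuclideanSpace.single x (1 : ℝ), (tsV1 hc Λ' w).C (EuclideanSpace.single x' (1 : ℝ))⟫_ℝ|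
      ≤ 2 / γ₀ * Real.exp (-(δ₀ * torusSupNorm M₀ (anc[x] - anc[x']))) := h
    _ ≤ 2 / γ₀ * (Real.exp (2 * δ₀ * ((L : ℝ) - 1)) * Real.exp (-(δ₀ * torusSupNorm M₀ (rep M₀ x - rep M₀ x')))) :=
        mul_le_mul_of_nonneg_left hexp hγ
    _ = _ := by ring

end Decay

/-! ## §5  The order of quantifiers: «independent of j and Λ» -/

section Uniform

/-- **«… WITH AN EXPONENTIAL DECAY INDEPENDENT OF j AND Λ»** with the order of quantifiers literal: for every dimension `d + 1` and block size
`L` there is `δ > 0` such that for every volume `(m, K)`, every `c ≠ 0`, every level `j + 1 ≤ m + K`, every `Λ′ ⊂ T^{(j+1)}`, all weights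
`w > 0` and all sites `x, x′ ∈ T^{(j)}`, `|⟨e_x, C^{(j)}_Λe_{x′}⟩| ≤ (2/γ₀)·e^{−δ|x̂ − x̂′|_T}`, `γ₀ = (c/L^j)⁴L^{j(d+1)}c₀(d+1)(8/L²)²`.
[cite: Balaban1984PropagatorsII, p.242 (text after (2.110))] -/
theorem cov_kernel_decay_uniform (d L : ℕ) (hd : 1 ≤ d + 1) (hL : Odd L ∧ 1 < L) :
    ∃ δ : ℝ, 0 < δ ∧ ∀ (m K : ℕ) (c : ℝ) (hc : c ≠ 0) (j : ℕ) (_hj : j + 1 ≤ m + K)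
      (Λ' : Finset (Site P₀ (j + 1))) (w : CIdx j Λ' → ℝ) (_hw : ∀ i, 0 < w i) (x x' : Site P₀ j),
      |⟪EuclideanSpace.single x (1 : ℝ), (tsV1 hc Λ' w).C (EuclideanSpace.single x' (1 : ℝ))⟫_ℝ| ≤
        2 / γ₀ * Real.exp (-(δ * torusSupNorm M₀ (anc[x] - anc[x']))) :=
  ⟨δ₀, delta0_pos hL, fun _ _ _ hc _ hj Λ' _ hw x x' => cov_kernel_decay hc Λ' hw hj x x'⟩

end Uniform

end Literature.MathematicalPhysics.QuantumFieldTheory.Balaban1983to89.B6Cov2110DecayV1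

end
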